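import Summits.BirchSwinnertonDyer.BirchSwinnertonDyer.Theorems.PrintCf2RubinValueTwoEllipticUnitsTwoVariableMomentsArtinSteps
import Literature.NumberTheory.EllipticCurves.PAdicOneVariableRayCharacterContinuous
import Literature.NumberTheory.NumberFields.RayClassFieldAdicTowerArtinClassesDegreeOne
import HarnessLib

/-!
# The p-adic side of de Shalit II.4.14 (38)–(40) at the modulus `𝔣_m` as a CLASS SUM over a system of representatives of `Cl(𝔣_m)`
# (II.4.7 (16)–(17), II.4.11, II.4.17: `𝒢/G = Gal(K(𝔣)/K) ≅ Cl(𝔣)` at `p = 2`), tower-continuity discharged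

Cell `bsd-print-cf2`, width seat `bsd-line-cf2-p1-w8` g11 (piece (H13) = the MEASURE-SIDE HALF of the (e)-assembler's seam `hsum`);
`--supports` the banked S3a item stmt-BirchSwinnertonDyer-24721 (helper, Theses-free).  THEOREMS ONLY; CONDITIONAL on the published named
facts `DeShalit1987.prop24_ii_galoisAction`, `prop24_iii_unit`, `prop25_i_normRelation` (hypotheses, never asserted).

`…TwoVariableMomentsArtinSteps.integral_twoVariable_character_pow_succ_artin_steps` (H11) computes `∫_{Γ_K} χ dμ` as a sum over the CELLS
`Γ_K/Gal(K̄/K(𝔣_m v))` labelled by family ideals `𝔞(c′)` with `g_{𝔞(c′)} ∈ c′⁻¹`, under a tower-continuity hypothesis on `χ`.  The assembler's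
seam (`…KatzMeasureJZeroIntegrandOfClassSums`, hypothesis `hsum`) wants a sum over a system of representatives `T` of the ray classes
MOD `𝔣_m` (no `v`).  THIS file makes the three bookkeeping steps once and for all:
(1) tower-continuity of `χ` FOLLOWS from multiplicativity and the restriction identity `χ|_{Gal(K̄/K(𝔣_m))} = (e₂κ_v)^{−(k+1)}`
(`isTowerContinuous_absRayAdicTower_of_restrict_eq_character_pow`); (2) labels exist as soon as the family contains every ideal prime to
`𝔣_m v` (`exists_ideal_forall_proj_zero_eq`), they are injective on the cells and their ideals form a system of representatives mod `𝔣_m v`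
(`isRayClassReps_image_of_artin_labels`), (3) which at `p = 2` (`𝒪_v ≅ ℤ₂`, `K(𝔣_m v) = K(𝔣_m)`) is a system of representatives mod `𝔣_m`
(`IsRayClassReps.of_mul_pow_of_padicIntEquiv_two`):

* ★★★ `exists_reps_integral_twoVariable_eq_classSum` — **∃ a finite set `T` of family indices whose ideals form a system of representatives of
  the ray classes mod `𝔣_m` (the index-to-ideal map injective on `T`) with
  `∫_{Γ_K} χ dμ = (χ(g_𝔠) − N𝔠)⁻¹ · Σ_{i ∈ T} χ(g_i⁻¹) · ([S⁰] D^k H_{e_{𝔣_m}(𝔦𝔠)_𝔓} − N𝔠 · [S⁰] D^k H_{e_{𝔣_m}(𝔦)_𝔓})`**, `𝔦 = idl i`,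
  for every multiplicative `χ` with `χ(1) = 1`, `χ(g_𝔠) ≠ N𝔠` and the restriction identity — NO continuity hypothesis, NO labels to supply;
* `exists_family_index_eq` — the hypothesis `hI` for the family of ALL non-zero ideals prime to `𝔣_0 v` (the index set of
  `…TwoVariableMeasureDischargedSteps`); its `mulc` is `fun i ↦ ⟨i.1 * 𝔠.1, mul_ne_zero i.2.1 𝔠.2.1, i.2.2.mul_left 𝔠.2.2⟩`, `hmulc = fun _ ↦ rfl`.

HONEST FRAMING: an assembly of accepted kernel theorems over published named facts; nothing here closes a crux; no summit statement is
proved; BSD is not proved by any of this.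

## References
* [deShalit1987] E. de Shalit, *Iwasawa theory of elliptic curves with complex multiplication* (1987), II.4.7 (16)–(17) (p. 60), II.4.11
  (p. 65), II.4.14 (38)–(40) (p. 71–72), II.4.17 (p. 77–78).
* [NeukirchANT1999] J. Neukirch, *Algebraic Number Theory* (1999), Ch. VI §7 Thm. (7.1), Ch. VI §1 (1.8).
-/

-- the summit namespace `Summit.BirchSwinnertonDyer.BirchSwinnertonDyer` repeats the problem name by design (D-0017)
set_option linter.dupNamespace false
set_option autoImplicit false

noncomputable section

open scoped Classical nonZeroDivisors
open scoped NumberField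
open Field IsDedekindDomain IsDedekindDomain.HeightOneSpectrum ValuativeRel IsLocalRing MvPowerSeries
open Literature.NumberTheory.NumberFields
open Literature.NumberTheory.GaloisRepresentations Literature.NumberTheory.GaloisRepresentations.IsNonarchimedeanLocalField
  Literature.NumberTheory.GaloisRepresentations.LubinTate Literature.NumberTheory.GaloisRepresentations.ArtinLocalGlobal
  Literature.NumberTheory.PAdicHodge
open Literature.NumberTheory.EllipticCurves Literature.NumberTheory.EllipticCurves.GroupDistribution
open Literature.NumberTheory.ComplexMultiplication.EllipticUnits
open Literature.NumberTheory.LFunctions (IsRayClassReps RayClassRel)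
open Literature.NumberTheory.LFunctions.AbelianDensity (artinSymbol)
open Summit.BirchSwinnertonDyer.BirchSwinnertonDyer.Theorems.PrintCf2.EllipticUnitsLocal
open Summit.BirchSwinnertonDyer.BirchSwinnertonDyer.Theorems.PrintCf2.EllipticUnitsGlobal
open Summit.BirchSwinnertonDyer.BirchSwinnertonDyer.Theorems.PrintCf2.EllipticUnitsGlobalCompat

namespace Summit.BirchSwinnertonDyer.BirchSwinnertonDyer.Theorems.PrintCf2.EllipticUnitsTwoVariable


variable {K : Type} [Field K] [NumberField K] {v : HeightOneSpectrum (𝓞 K)}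

attribute [local instance] GlobalNormCoherentUnits.instCommMonoid GlobalNormCoherentUnits.galAction
attribute [local instance] ltNormUniformSpace ltNormIsUniformAddGroup rk1 nF nE fintypeResidueField
attribute [local instance] RelNormCoherentUnits.instCommMonoid

variable [NumberField.IsTotallyComplex K]
  -- the prints and the global frame
  (h24ii : DeShalit1987.prop24_ii_galoisAction) (h24iii : DeShalit1987.prop24_iii_unit) (h25 : DeShalit1987.prop25_i_normRelation)
  (hK : IsImaginaryQuadratic K) (ι : K →+* ℂ)
  -- the moduli: ANY one-prime-step chain `𝔣_{m+1} = 𝔣_m 𝔩_m`, `𝔩_m ∣ 𝔣_m` (`hstep`), all rigid and prime to `v`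
  (𝔣 : ℕ → Ideal (𝓞 K)) (hle : ∀ m, 𝔣 (m + 1) ≤ 𝔣 m)
  (h𝔣0 : ∀ m, 𝔣 m ≠ ⊥) (h𝔣1 : ∀ m, 𝔣 m ≠ ⊤) (hv : ∀ m, ¬ 𝔣 m ≤ v.asIdeal) (hw : ∀ (m : ℕ) (u : (𝓞 K)ˣ), (u : 𝓞 K) - 1 ∈ 𝔣 m → u = 1)
  -- the common local datum at `v`: `π = u·2`, `σ₀`, `ε`, `θ`, `e₂`
  (hq : residueFieldCard (v.adicCompletion K) = 2)
  (h2 : (valuation (v.adicCompletion K)).IsUniformizer ((((2 : ℕ) : 𝒪[v.adicCompletion K]) : v.adicCompletion K)))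
  (u : 𝒪[v.adicCompletion K]ˣ)
  {σ₀ : absoluteGaloisGroup (v.adicCompletion K)} (hσ₀ : IsAbsArithFrob σ₀)
  {ε : (maxUnramifiedCompletion (v.adicCompletion K))ˣ}
  (hε : maxUnramifiedCompletion.galAut (v.adicCompletion K) σ₀ (ε : maxUnramifiedCompletion (v.adicCompletion K)) =
    algebraMap 𝒪[v.adicCompletion K] (maxUnramifiedCompletion (v.adicCompletion K)) (u : 𝒪[v.adicCompletion K]) *
      (ε : maxUnramifiedCompletion (v.adicCompletion K)))
  (θ : CompletedAlgClosure (v.adicCompletion K) →+* ℂ_[2]) (hθc : Continuous θ)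
  (hθ1 : ∀ z : CBall (v.adicCompletion K), ‖θ (z : CompletedAlgClosure (v.adicCompletion K))‖ ≤ 1)
  (hθζ : ∀ ζ' : ℂ_[2], (∃ n : ℕ, ζ' ^ 2 ^ n = 1) →
    ∃ ζ : CompletedAlgClosure (v.adicCompletion K), (∃ n : ℕ, ζ ^ 2 ^ n = 1) ∧ θ ζ = ζ')
  (e₂ : v.adicCompletionIntegers K ≃+* ℤ_[2])
  (hΘe : ∀ a : 𝒪[v.adicCompletion K], (θ.comp ((CBall (v.adicCompletion K)).subtype.comp
      (algebraMap (UnrCoeff (v.adicCompletion K)) (CBall (v.adicCompletion K))))) (intToUnrCoeff (v.adicCompletion K) a) =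
    padicIntCast ℂ_[2] (((e₂ : v.adicCompletionIntegers K →+* ℤ_[2]).comp
      (integerEquivAdicCompletionIntegers v).toRingHom) a))
  -- the per-modulus local models: global witnesses `α_m = π^{f_m}`, coefficient fields `E_m ≤ E_{m+1}`, readings `j_m`, cell maps `ψ_m`
  (α : ℕ → 𝓞 K) (hα0 : ∀ m, α m ≠ 0) (hα𝔣 : ∀ m, α m - 1 ∈ 𝔣 m) (hαw : ∀ m (w : HeightOneSpectrum (𝓞 K)), w ≠ v → α m ∉ w.asIdeal)
  (f : ℕ → ℕ) (hαπ : ∀ m, ((α m : K) : v.adicCompletion K) =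
    ((((u : 𝒪[v.adicCompletion K]) * ((2 : ℕ) : 𝒪[v.adicCompletion K]) : 𝒪[v.adicCompletion K]) : v.adicCompletion K)) ^ f m)
  (E : ℕ → IntermediateField (v.adicCompletion K) (AlgebraicClosure (v.adicCompletion K)))
  [hfd : ∀ m, FiniteDimensional (v.adicCompletion K) (E m)] [hgal : ∀ m, IsGalois (v.adicCompletion K) (E m)]
  (hE : ∀ m, E m ≤ maxUnramified (v.adicCompletion K))
  (hdegE : ∀ (m : ℕ) (w : WeilGroup (v.adicCompletion K)),
    WeilGroup.toAbsGalois (v.adicCompletion K) w ∈ (E m).fixingSubgroup → (f m : ℤ) ∣ WeilGroup.deg w)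
  (hEE : ∀ m, E m ≤ E (m + 1))
  (j : ∀ m : ℕ, unitBall (E m) →+* UnrCoeff (v.adicCompletion K))
  (hj : ∀ m, (j m).comp (algebraMap (LTCoeff (v.adicCompletion K)) (unitBall (E m))) =
    (intToUnrCoeff (v.adicCompletion K)).comp (LTCoeff.of (v.adicCompletion K)).symm.toRingHom)
  (hjC : ∀ m, (algebraMap (UnrCoeff (v.adicCompletion K)) (CBall (v.adicCompletion K))).comp (j m) = unitBallToCBall (E m))
  (hjj : ∀ (m : ℕ) (y : unitBall (E m)), j (m + 1) (inclUnitBall (F := v.adicCompletion K) (hEE m) y) = j m y)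
  (ψ : ∀ m n : ℕ, ↥(absRestrictNormalHom (rayClassField K (𝔣 m))).ker ⧸ (rayAdicTower (𝔪 := 𝔣 m) (h𝔣0 m) v).U n → ZMod (2 ^ (n + 1)))
  (hψ : ∀ (m n : ℕ) (g : ↥(absRestrictNormalHom (rayClassField K (𝔣 m))).ker), g ∈ (rayAdicTower (𝔪 := 𝔣 m) (h𝔣0 m) v).U 0 →
    ψ m n ((rayAdicTower (𝔪 := 𝔣 m) (h𝔣0 m) v).proj n g) =
      PadicInt.toZModPow (n + 1) ((((Units.map (e₂ : v.adicCompletionIntegers K →+* ℤ_[2]).toMonoidHom).comp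
        (rayAdicCharacter (h𝔣0 m) (hv m) (hw m)))⁻¹ g : ℤ_[2]ˣ) : ℤ_[2]))
  -- the twists: ideals `𝔠` prime to all `𝔣_m v`, Galois lifts `g_𝔠 ∈ Γ_K` of their Artin symbols on every `K(𝔣_m v^{k+1})`,
  -- elliptic-unit families at every modulus
  {I : Type*} (idl : I → Ideal (𝓞 K)) (hidl0 : ∀ i, idl i ≠ ⊥) (hidlc : ∀ i m, IsCoprime (idl i) (𝔣 m * v.asIdeal))
  (g : I → absoluteGaloisGroup K)
  (hg : ∀ (i : I) (m k : ℕ), absRestrictNormalHom (rayClassField K (𝔣 m * v.asIdeal ^ (k + 1))) (g i) =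
    artinSymbol (galFrob K (rayClassField K (𝔣 m * v.asIdeal ^ (k + 1)))) (idl i))
  (x : ∀ (i : I) (m k : ℕ), rayClassField K (𝔣 m * v.asIdeal ^ (k + 1)))
  (hx : ∀ (i : I) (m k : ℕ), IsThetaValueOne ι (𝔣 m * v.asIdeal ^ (k + 1)) (idl i)
    (algClosureEmb ι ((x i m k : rayClassField K (𝔣 m * v.asIdeal ^ (k + 1))) : AlgebraicClosure K)))
  [hN : ∀ m n, ((rayAdicTower (𝔪 := 𝔣 m) (h𝔣0 m) v).U n).Normal]
  [hNabs : ∀ m n, ((absRayAdicTower (𝔪' := 𝔣 m) (h𝔣0 m) v).U n).Normal]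

omit [NumberField.IsTotallyComplex K] in
include hle in
/-- **The family of ALL non-zero ideals prime to `𝔣_0 v`** (the index set of `…TwoVariableMeasureDischargedSteps`) **contains every non-zero
ideal prime to `𝔣_m v`** (`𝔣_m ⊆ 𝔣_0` along the chain) — the hypothesis `hI` of `exists_reps_integral_twoVariable_eq_classSum` for that family.
[cite: deShalit1987, II.4.14 Step 1 (p. 71)] -/
theorem exists_family_index_eq (m : ℕ) (𝔞 : Ideal (𝓞 K)) (h0 : 𝔞 ≠ ⊥) (hc : IsCoprime 𝔞 (𝔣 m * v.asIdeal)) :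
    ∃ i : {c : Ideal (𝓞 K) // c ≠ ⊥ ∧ IsCoprime c (𝔣 0 * v.asIdeal)}, i.1 = 𝔞 := by
  have hle0 : ∀ n : ℕ, 𝔣 n ≤ 𝔣 0 := fun n ↦ by
    induction n with
    | zero => exact le_rfl
    | succ n ih => exact (hle n).trans ih
  exact ⟨⟨𝔞, h0, hc.of_isCoprime_of_dvd_right (mul_dvd_mul_right (Ideal.dvd_iff_le.mpr (hle0 m)) _)⟩, rfl⟩

set_option maxHeartbeats 1600000 in
include h24ii hj hΘe hjj hθc hθζ hg in
/-- ★★★ **THE p-ADIC SIDE OF II.4.14 (38)–(40) AT THE MODULUS `𝔣_m` AS A CLASS SUM OVER REPRESENTATIVES OF `Cl(𝔣_m)`.**  In the setting of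
`integral_twoVariable_character_pow_succ_artin_steps` (a one-prime-step chain `𝔣`, the measure `μ` with `δ_{g_𝔠,N𝔠} μ = i_n(e_{𝔣_n}(𝔠))`, a
multiplicative `χ` with `χ(1) = 1`, `χ(g_𝔠) ≠ N𝔠` and `χ|_{Gal(K̄/K(𝔣_m))} = (e₂κ_v)^{−(k+1)}`), assume the family contains every non-zero ideal
prime to `𝔣_m v` (`hI`) and is closed under `𝔦 ↦ 𝔦𝔠` (`mulc`).  Then **there is a finite set `T` of indices, on which `idl` is injective, whose
ideals form a system of representatives of the ray classes mod `𝔣_m`, with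
`∫_{Γ_K} χ dμ = (χ(g_𝔠) − N𝔠)⁻¹ · Σ_{i∈T} χ(g_i⁻¹) · ([S⁰] D^k H_{e_{𝔣_m}(𝔦𝔠)_𝔓} − N𝔠 · [S⁰] D^k H_{e_{𝔣_m}(𝔦)_𝔓})`** — de Shalit's
`Σ_{σ ∈ 𝒢/G} ε(σ)⁻¹ ∫_G …` read over `Cl(𝔣_m) ≅ 𝒢/G` (II.4.17: at `p = 2`, `Gal(K̄/K(𝔣_m𝔭)) = Gal(K̄/K(𝔣_m))`).  Tower-continuity of `χ` is
DERIVED (`isTowerContinuous_absRayAdicTower_of_restrict_eq_character_pow`); the labels come from `exists_ideal_forall_proj_zero_eq`.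
GIVEN II.2.4 (ii)/(iii), II.2.5 (i). [cite: deShalit1987, II.4.14 (38)–(40) (p. 71–72), II.4.7 (16)–(17) (p. 60), II.4.11 (p. 65), II.4.17 (p. 77–78)]
[cite: NeukirchANT1999, Ch. VI §7 Thm. (7.1)] -/
theorem exists_reps_integral_twoVariable_eq_classSum
    (hstep : ∀ m, ∃ 𝔩 : HeightOneSpectrum (𝓞 K), 𝔣 (m + 1) = 𝔣 m * 𝔩.asIdeal ∧ 𝔩.asIdeal ∣ 𝔣 m)
    (μ : GroupDistribution (SubgroupTower.diagonal (fun m ↦ absRayAdicTower (𝔪' := 𝔣 m) (h𝔣0 m) v)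
        (fun m n ↦ absRayAdicTower_U_anti (h𝔣0 m) (h𝔣0 (m + 1)) v (hle m) n)) ℂ_[2]) (c : I)
    (hμ : ∀ (n : ℕ) (b : absoluteGaloisGroup K ⧸ (absRayAdicTower (𝔪' := 𝔣 n) (h𝔣0 n) v).U n),
        (twisting (g c) (Ideal.absNorm (idl c) : ℂ_[2]) μ).μ n b =
        (GroupDistribution.induceFrom (Γ := absoluteGaloisGroup K) (fun k ↦ rayAdicTower_U_eq_subgroupOf (𝔪 := 𝔣 n) (h𝔣0 n) v k)
          (fun b : GlobalNormCoherentUnits (h𝔣0 n) v ↦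
            localMeasureFamily (h𝔣0 n) (hv n) (hw n) hq h2 u (E n) (hE n) hσ₀ hε θ hθ1 (j n) (hjC n) e₂ (ψ n) (hψ n)
              (RelNormCoherentUnits.ofGlobalUnits (h𝔣0 n) (hv n) (hw n) (isUniformizer_unit_mul h2 u) (hα0 n) (hα𝔣 n) (hαw n)
                (hαπ n) (E n) (hE n) (hdegE n) b))
          zero_le_one (fun _ ↦ le_rfl)
          (ellipticUnitsGlobal h24iii h25 hK ι (h𝔣0 n) (h𝔣1 n) (hv n) (hw n) (hidl0 c) (hidlc c n) (x c n) (hx c n))).μ n b)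
    (m k : ℕ) {χ : absoluteGaloisGroup K → ℂ_[2]}
    (hχ : ∀ y z, χ (y * z) = χ y * χ z) (h1 : χ 1 = 1) (hne : χ (g c) ≠ (Ideal.absNorm (idl c) : ℂ_[2]))
    (hχG : ∀ y : ↥(absRestrictNormalHom (rayClassField K (𝔣 m))).ker, χ y =
      padicIntCast ℂ_[2] (((((Units.map (e₂ : v.adicCompletionIntegers K →+* ℤ_[2]).toMonoidHom).comp
        (rayAdicCharacter (h𝔣0 m) (hv m) (hw m)))⁻¹) y : ℤ_[2]) ^ (k + 1)))
    (hI : ∀ 𝔞 : Ideal (𝓞 K), 𝔞 ≠ ⊥ → IsCoprime 𝔞 (𝔣 m * v.asIdeal) → ∃ i : I, idl i = 𝔞)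
    (mulc : I → I) (hmulc : ∀ i, idl (mulc i) = idl i * idl c) :
    ∃ T : Finset I, IsRayClassReps (𝔣 m) (T.image idl) ∧ Set.InjOn idl (T : Set I) ∧
      μ.integral χ = (χ (g c) - (Ideal.absNorm (idl c) : ℂ_[2]))⁻¹ *
        ∑ i ∈ T, χ ((g i)⁻¹) *
          (PowerSeries.constantCoeff (mahlerD^[k] ((PowerSeries.subst (compSeriesC h2 hσ₀ u hε)
            ((relTildeSeries (isUniformizer_unit_mul h2 u) (E m) hq (hE m) hσ₀
              (LTCoeff.of (v.adicCompletion K) (u : 𝒪[v.adicCompletion K]))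
              (RelNormCoherentUnits.ofGlobalUnits (h𝔣0 m) (hv m) (hw m) (isUniformizer_unit_mul h2 u) (hα0 m) (hα𝔣 m) (hαw m)
                (hαπ m) (E m) (hE m) (hdegE m)
                (ellipticUnitsGlobal h24iii h25 hK ι (h𝔣0 m) (h𝔣1 m) (hv m) (hw m) (hidl0 (mulc i)) (hidlc (mulc i) m) (x (mulc i) m)
                  (hx (mulc i) m)))).map (j m))).map
            (θ.comp ((CBall (v.adicCompletion K)).subtype.comp
              (algebraMap (UnrCoeff (v.adicCompletion K)) (CBall (v.adicCompletion K))))))) -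
          (Ideal.absNorm (idl c) : ℂ_[2]) *
            PowerSeries.constantCoeff (mahlerD^[k] ((PowerSeries.subst (compSeriesC h2 hσ₀ u hε)
            ((relTildeSeries (isUniformizer_unit_mul h2 u) (E m) hq (hE m) hσ₀
              (LTCoeff.of (v.adicCompletion K) (u : 𝒪[v.adicCompletion K]))
              (RelNormCoherentUnits.ofGlobalUnits (h𝔣0 m) (hv m) (hw m) (isUniformizer_unit_mul h2 u) (hα0 m) (hα𝔣 m) (hαw m)
                (hαπ m) (E m) (hE m) (hdegE m)
                (ellipticUnitsGlobal h24iii h25 hK ι (h𝔣0 m) (h𝔣1 m) (hv m) (hw m) (hidl0 i) (hidlc i m) (x i m)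
                  (hx i m)))).map (j m))).map
            (θ.comp ((CBall (v.adicCompletion K)).subtype.comp
              (algebraMap (UnrCoeff (v.adicCompletion K)) (CBall (v.adicCompletion K)))))))) := by
  -- (1) tower-continuity from the restriction identity
  have hχc : (absRayAdicTower (𝔪' := 𝔣 m) (h𝔣0 m) v).IsTowerContinuous χ :=
    isTowerContinuous_absRayAdicTower_of_restrict_eq_character_pow (h𝔣0 m) (hv m) (hw m) e₂ hχ (k + 1) hχG
  -- (2) labels: for every cell `c′` a family index whose lift lies in `c′⁻¹`
  have hA : ∀ c' : absoluteGaloisGroup K ⧸ (absRayAdicTower (𝔪' := 𝔣 m) (h𝔣0 m) v).U 0, ∃ i : I,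
      (absRayAdicTower (𝔪' := 𝔣 m) (h𝔣0 m) v).proj 0 (g i) = c'⁻¹ := fun c' ↦ by
    obtain ⟨𝔞, h0, hc, h⟩ := exists_ideal_forall_proj_zero_eq (h𝔣0 m) v c'⁻¹
    obtain ⟨i, hi⟩ := hI 𝔞 h0 (by simpa only [zero_add, pow_one] using hc)
    exact ⟨i, h (g i) (by rw [hg i m 0, hi])⟩
  choose a ha using hA
  have hac : ∀ c', IsCoprime ((idl ∘ a) c') (𝔣 m * v.asIdeal ^ ((0 : ℕ) + 1)) := fun c' ↦ isCoprime_mul_pow_succ (hidlc (a c') m) 0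
  have hbij : Function.Bijective fun c' ↦ (absRayAdicTower (𝔪' := 𝔣 m) (h𝔣0 m) v).proj 0 ((g ∘ a) c') := by
    simp only [Function.comp_apply, ha]
    exact inv_involutive.bijective
  have hinj : ∀ c₁ ∈ (absRayAdicTower (𝔪' := 𝔣 m) (h𝔣0 m) v).cells 0, ∀ c₂ ∈ (absRayAdicTower (𝔪' := 𝔣 m) (h𝔣0 m) v).cells 0,
      a c₁ = a c₂ → c₁ = c₂ := fun c₁ _ c₂ _ h ↦
    eq_of_artin_labels_eq (h𝔣0 m) v (idl ∘ a) (fun c' ↦ hidl0 (a c')) hac (g ∘ a) (fun c' ↦ hg (a c') m 0) hbij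
      (show idl (a c₁) = idl (a c₂) by rw [h])
  refine ⟨((absRayAdicTower (𝔪' := 𝔣 m) (h𝔣0 m) v).cells 0).image a, ?_, ?_, ?_⟩
  · -- (3) representatives mod `𝔣_m v`, hence mod `𝔣_m` at `p = 2`
    rw [Finset.image_image]
    exact Literature.NumberTheory.NumberFields.IsRayClassReps.of_mul_pow_of_padicIntEquiv_two (h𝔣0 m) (hv m) (hw m) e₂
      (isRayClassReps_image_of_artin_labels (h𝔣0 m) v (idl ∘ a) (fun c' ↦ hidl0 (a c')) hac (g ∘ a) (fun c' ↦ hg (a c') m 0) hbij)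
  · intro i hi i' hi' h
    obtain ⟨c₁, hc₁, rfl⟩ := Finset.mem_image.mp hi
    obtain ⟨c₂, hc₂, rfl⟩ := Finset.mem_image.mp hi'
    rw [eq_of_artin_labels_eq (h𝔣0 m) v (idl ∘ a) (fun c' ↦ hidl0 (a c')) hac (g ∘ a) (fun c' ↦ hg (a c') m 0) hbij
      (c := c₁) (c' := c₂) h]
  · rw [integral_twoVariable_character_pow_succ_artin_steps h24ii h24iii h25 hK ι 𝔣 hle h𝔣0 h𝔣1 hv hw hq h2 u hσ₀ hε θ hθc hθ1
      hθζ e₂ hΘe α hα0 hα𝔣 hαw f hαπ E hE hdegE hEE j hj hjC hjj ψ hψ idl hidl0 hidlc g hg x hx hstep μ c hμ m k hχc hχ h1 hne hχG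
      a ha (fun c' ↦ mulc (a c')) (fun c' ↦ hmulc (a c')), Finset.sum_image hinj]

end Summit.BirchSwinnertonDyer.BirchSwinnertonDyer.Theorems.PrintCf2.EllipticUnitsTwoVariable

end
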